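import Summits.NavierStokesRegularity.NavierStokesRegularity.Theorems.QuarterLogPincerTypeIQuantSubcubicExpTruncationEdgeStubs
import Summits.NavierStokesRegularity.NavierStokesRegularity.Theorems.LerayQuarterDissipationFiniteDissipationLiouvilleEnvelopeIff
import Summits.NavierStokesRegularity.NavierStokesRegularity.Theorems.AsymmetricFlickerLiouville.Negative.AsTypedIsFDL
import Literature.Analysis.FluidPDE.TypeIAncientMildRescale
import HarnessLib

/-!
# The `quiet_collar` objects, typed — refuter side, negative lane (II): the floor translates; wall placement

Crux `stmt-NavierStokesRegularity-24077` (`QuarterLogPincer.TypeIQuantSubcubicExp`), line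
`Cruxes/TypeIQuantSubcubicExp/Lines/quiet_collar.lean` v1.1 (ns-idea-7 g9, 2026-08-28; tree sha16
`8170489f8bcaaff9`; stubs QP1 `stub_quietCollar`, QP2 `stub_cutPair`, QP3 `stub_forcedTwoNormShadowing`,
Q2 `stub_logCubeExtraction`, Q3 `stub_localRateFloor`; Q1 `stub_quietTruncation` DERIVED from QP1–QP3 and
the landed frame bootstrap; values `LogCubeFloorLiouville`, `LogCubeLiouville`); and crux
`stmt-NavierStokesRegularity-24453` (`CalmSliceGate.AsymmetricFlickerLiouville`).

The line's objects live in a Cruxes workfile (not importable from `Theorems/`), so every statement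
below is written over their BODIES, verbatim (`LocalRateFloor v` =
`∃ c s₀, 0 < c ∧ s₀ < 0 ∧ ∀ s ∈ Ico s₀ 0, ∃ x ∈ ball 0 1, c/√(−s) ≤ ‖v s x‖`;
`LogCubeLiouville` = `∀ M v, IsTypeIAncientMild M v → EnvelopeCubeBudget v → ¬ SingularAt v 0`;
`LogCubeFloorLiouville` = `… → ¬ LocalRateFloor v`; Q1 = `… → EnvelopeCubeBudget v → ∃ M',
FarFieldTruncation M' v`; Q2 = `¬ 24077 → ∃ M v, IsTypeIAncientMild M v ∧ EnvelopeCubeBudget v ∧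
LocalRateFloor v`; Q3 = `… → SingularAt v 0 → LocalRateFloor v`; QP1 = `… → QuietCollar v`; QP2 =
`… → CutPair v` with `mildDefect V t x` unfolded to `V t x − heatFlow (V 0) t x + oseenDuhamel 1 0 V V t x`),
over the landed Theorems-level definitions `TaoFrame`, `SingularAt`, `EnvelopeCubeBudget`,
`FarFieldTruncation`, `HasTypeIDecay`, `IsTypeIAncientMild`, `heatFlow`, `oseenDuhamel`; the by-name
identity of each body with the line's `def` is an `Iff.rfl` check against a verbatim copy of the line (seat
folder `qc/QC4.lean`, rc 0). Nothing here asserts 24077, 24453, 22144, 4050 or a stub: every statement is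
an implication between OPEN statements, a statement about the rest state, or pure logic. No summit
statement and no crux is proved by this file.

## Findings (kernel-checked below)

Findings 1–2 (the consistency ceiling under item 4050; Q2 = the converse edge) are in the companion
file `Negative/QuietCollarRestState.lean`.

3. `LogCubeLiouville → LogCubeFloorLiouville` WITHOUT Q3 (`logCubeFloorLiouville_of_logCubeLiouville`):
   a localised Leray floor forces a singular point `a` in the CLOSED unit ball (compactness,
   `exists_singularAt_of_localRateFloor`), and the class, the budget (constant `(1 + log 2)·B`,
   `B(a,R) ⊂ B(0,2R)`) and singularity are translation-covariant
   (`IsTypeIAncientMild.comp_add_right`, `envelopeCubeBudget_comp_add_right`,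
   `singularAt_comp_add_right`). Q3 serves only the upgrade `LogCubeFloorLiouville → LogCubeLiouville`.
4. PLACEMENT ON THE WALL. `LogCubeFloorLiouville` (hence `LogCubeLiouville`) implies the
   envelope-class Liouville statement, i.e. `FiniteDissipationLiouville` (22144) ⟺
   `AsymmetricFlickerLiouville` (24453) ⟺ `PerpetualFlickerLiouville` (24374), by the landed T3
   (`stub_envelopeCubeBudget`) and the rung `localRateFloor_of_hasTypeIDecay_of_singularAt` (the
   line's `localRateFloor_of_hasTypeIDecay`, re-proved here over landed T4 `stub_rateFloor`).
   INSTRUMENT ROW AS THEOREM: any enveloped singular Type-I ancient mild field, any Type-I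
   (rotated-)DSS profile `IsTypeIDSSProfile c R u` (every ratio `c > 1`, every isometry `R`), and any
   failure of `TypeIDSSLiouvilleConjecture` refutes BOTH values of the line together with 22144,
   24453, 24374 and 24077 (for log-budget objects given Q1; for enveloped objects unconditionally,
   by the landed edge `TruncationEdge.edge_finiteDissipationLiouville`, typer g35 p674726)
   (`not_logCubeFloorLiouville_of_isTypeIDSSProfile`, `…_of_not_asymmetricFlickerLiouville`,
   `…_of_not_typeIDSSLiouvilleConjecture`). The seat's verdict tables (VERDICT-TABLES-DSS v1/v2:
   0 certified candidates) therefore bear on `quiet_collar` with no new row type.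
-/

-- the summit and its single sub-problem share the name (CONVENTIONS §1), as in every Theorems file
set_option linter.dupNamespace false

namespace Summit.NavierStokesRegularity.NavierStokesRegularity.Theorems.TypeIQuantSubcubicExp.Negative

open MeasureTheory Set Filter Topology Metric Function
open Literature.Analysis Literature.Analysis.FluidPDE
open Summit.NavierStokesRegularity.NavierStokesRegularity.Theorems
open Summit.NavierStokesRegularity.NavierStokesRegularity.Cruxes.TypeIQuantSubcubicExp.ThinCascade
  (TaoFrame SingularAt)
open Summit.NavierStokesRegularity.NavierStokesRegularity.Cruxes.TypeIQuantSubcubicExp.TruncationEdge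
  (EnvelopeCubeBudget stub_envelopeCubeBudget stub_rateFloor)

open scoped ENNReal NNReal

/-! ### 3. `LogCubeLiouville → LogCubeFloorLiouville` without Q3 -/

/-- **A localised Leray floor forces a singular point in the CLOSED unit ball** (compactness: floor
points `xₙ ∈ B₁` at times `sₙ = max s₀ (−1/(n+1)) → 0⁻` accumulate at some `a ∈ B̄₁`, where the
floor `c/√(−sₙ) → ∞` makes `v` unbounded on every backward parabolic neighbourhood). [folklore] -/
theorem exists_singularAt_of_localRateFloor
    {v : ℝ → EuclideanSpace ℝ (Fin 3) → EuclideanSpace ℝ (Fin 3)}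
    (h : ∃ c s₀ : ℝ, 0 < c ∧ s₀ < 0 ∧ ∀ s ∈ Set.Ico s₀ 0,
      ∃ x ∈ Metric.ball (0 : EuclideanSpace ℝ (Fin 3)) 1, c / Real.sqrt (-s) ≤ ‖v s x‖) :
    ∃ a ∈ Metric.closedBall (0 : EuclideanSpace ℝ (Fin 3)) 1, SingularAt v a := by
  obtain ⟨c, s₀, hc, hs₀, hfl⟩ := h
  set s : ℕ → ℝ := fun n => max s₀ (-(1 / ((n : ℝ) + 1))) with hs
  have hsneg : ∀ n : ℕ, s n < 0 := fun n => by
    rw [hs]; refine max_lt hs₀ ?_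
    have : (0 : ℝ) < 1 / ((n : ℝ) + 1) := by positivity
    linarith
  have hsIco : ∀ n : ℕ, s n ∈ Set.Ico s₀ 0 := fun n => ⟨le_max_left _ _, hsneg n⟩
  choose x hx hfloor using fun n => hfl (s n) (hsIco n)
  have hxcl : ∀ n, x n ∈ Metric.closedBall (0 : EuclideanSpace ℝ (Fin 3)) 1 :=
    fun n => Metric.ball_subset_closedBall (hx n)
  obtain ⟨a, ha, φ, hφ, hlim⟩ :=
    (isCompact_closedBall (0 : EuclideanSpace ℝ (Fin 3)) 1).tendsto_subseq hxcl
  refine ⟨a, ha, fun r hr A => ?_⟩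
  have hev1 : ∀ᶠ n in Filter.atTop, dist (x (φ n)) a < r :=
    (Metric.tendsto_nhds.1 hlim) r hr
  have hsge : ∀ n : ℕ, -(1 / ((n : ℝ) + 1)) ≤ s n := fun n => le_max_right _ _
  obtain ⟨N₁, hN₁⟩ : ∃ N : ℕ, ∀ n : ℕ, N ≤ n → -(r ^ 2) < -(1 / ((n : ℝ) + 1)) := by
    obtain ⟨N, hN⟩ := exists_nat_gt (1 / r ^ 2)
    refine ⟨N, fun n hn => ?_⟩
    have hr2 : 0 < r ^ 2 := by positivity
    have hn' : (1 / r ^ 2 : ℝ) < (n : ℝ) + 1 := by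
      have : (N : ℝ) ≤ n := by exact_mod_cast hn
      linarith
    have : 1 / ((n : ℝ) + 1) < r ^ 2 := by
      rw [div_lt_iff₀ (by positivity)]
      rw [div_lt_iff₀ hr2] at hn'
      linarith
    linarith
  obtain ⟨N₂, hN₂⟩ : ∃ N : ℕ, ∀ n : ℕ, N ≤ n → A < c / Real.sqrt (-s n) := by
    set η : ℝ := c / (|A| + 1) with hη
    have hηpos : 0 < η := by positivity
    obtain ⟨N, hN⟩ := exists_nat_gt (1 / η ^ 2)
    refine ⟨N, fun n hn => ?_⟩
    have hη2 : 0 < η ^ 2 := by positivity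
    have hn' : (1 / η ^ 2 : ℝ) < (n : ℝ) + 1 := by
      have : (N : ℝ) ≤ n := by exact_mod_cast hn
      linarith
    have hlt : 1 / ((n : ℝ) + 1) < η ^ 2 := by
      rw [div_lt_iff₀ (by positivity)]
      rw [div_lt_iff₀ hη2] at hn'
      linarith
    have hneg : 0 < -s n := by linarith [hsneg n]
    have hsn : -s n < η ^ 2 := by linarith [hsge n]
    have hsq : Real.sqrt (-s n) < η := by
      calc Real.sqrt (-s n) < Real.sqrt (η ^ 2) := Real.sqrt_lt_sqrt hneg.le hsn
        _ = η := Real.sqrt_sq hηpos.le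
    have hsqpos : 0 < Real.sqrt (-s n) := Real.sqrt_pos.2 hneg
    have h1 : A < |A| + 1 := by linarith [le_abs_self A]
    have h2 : |A| + 1 = c / η := by
      rw [hη, div_div_cancel₀ hc.ne']
    have h3 : c / η < c / Real.sqrt (-s n) := div_lt_div_of_pos_left hc hsqpos hsq
    linarith
  obtain ⟨n, hn1, hn2, hn3⟩ : ∃ n, dist (x (φ n)) a < r ∧ N₁ ≤ φ n ∧ N₂ ≤ φ n := by
    have hev2 : ∀ᶠ n in Filter.atTop, N₁ ≤ φ n := (hφ.tendsto_atTop).eventually_ge_atTop N₁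
    have hev3 : ∀ᶠ n in Filter.atTop, N₂ ≤ φ n := (hφ.tendsto_atTop).eventually_ge_atTop N₂
    exact ((hev1.and hev2).and hev3).exists.imp fun n h => ⟨h.1.1, h.1.2, h.2⟩
  refine ⟨s (φ n), ⟨lt_of_lt_of_le (hN₁ _ hn2) (hsge _), hsneg _⟩, x (φ n), ?_,
    lt_of_lt_of_le (hN₂ _ hn3) (hfloor _)⟩
  rwa [Metric.mem_ball]

/-- **Singularity is translation-covariant**: `v` singular at `(a,0)` ⇒ `v(·, · + a)` singular at
`(0,0)`. [folklore] -/
theorem singularAt_comp_add_right {v : ℝ → EuclideanSpace ℝ (Fin 3) → EuclideanSpace ℝ (Fin 3)}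
    {a : EuclideanSpace ℝ (Fin 3)} (h : SingularAt v a) :
    SingularAt (fun t x => v t (x + a)) 0 := by
  intro r hr A
  obtain ⟨t, ht, y, hy, hA⟩ := h r hr A
  refine ⟨t, ht, y - a, ?_, by simpa using hA⟩
  rw [Metric.mem_ball, dist_eq_norm] at hy
  rwa [Metric.mem_ball, dist_zero_right]

/-- **The envelope cube budget is covariant under translations by `‖a‖ ≤ 1`**, with constant
`(1 + log 2)·B`: `1_{B(0,R)} v(s, · + a)` is the translate of `1_{B(a,R)} v(s)`, `B(a,R) ⊂ B(0,2R)`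
for `R ≥ 2 ≥ 1 ≥ ‖a‖`, the `L³` norm is translation invariant, and
`B(1 + log(2R) + log(1/ε)) ≤ (1 + log 2)B(1 + log R + log(1/ε))`. [folklore] -/
theorem envelopeCubeBudget_comp_add_right
    {v : ℝ → EuclideanSpace ℝ (Fin 3) → EuclideanSpace ℝ (Fin 3)}
    {a : EuclideanSpace ℝ (Fin 3)} (ha : ‖a‖ ≤ 1) (h : EnvelopeCubeBudget v) :
    EnvelopeCubeBudget (fun t x => v t (x + a)) := by
  obtain ⟨B, hB, hbud⟩ := h
  refine ⟨(1 + Real.log 2) * B, by positivity, fun R hR ε hε => ?_⟩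
  obtain ⟨b, hb, hb3, hsl⟩ := hbud (2 * R) (by linarith) ε hε
  have hlog2 : 0 ≤ Real.log 2 := Real.log_nonneg (by norm_num)
  have hlogR : 0 ≤ Real.log R := Real.log_nonneg (by linarith)
  have hlogε : 0 ≤ Real.log (1 / ε) :=
    Real.log_nonneg (by rw [le_div_iff₀ hε.1]; linarith [hε.2])
  refine ⟨b, hb, ?_, fun s hs => ?_⟩
  · have h2R : Real.log (2 * R) = Real.log 2 + Real.log R :=
      Real.log_mul (by norm_num) (by linarith)
    rw [h2R] at hb3
    nlinarith [mul_nonneg (mul_nonneg hB hlog2) (add_nonneg hlogR hlogε)]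
  · -- the localised translate is the translate of the field localised to `B(a,R)`
    have e : (Metric.ball (0 : EuclideanSpace ℝ (Fin 3)) R).indicator (fun x => v s (x + a)) =
        fun x => (Metric.ball a R).indicator (v s) (x + a) := by
      funext x
      by_cases hx : x ∈ Metric.ball (0 : EuclideanSpace ℝ (Fin 3)) R
      · have hx' : x + a ∈ Metric.ball a R := by
          rw [Metric.mem_ball, dist_eq_norm, add_sub_cancel_right]
          rwa [Metric.mem_ball, dist_zero_right] at hx
        rw [Set.indicator_of_mem hx, Set.indicator_of_mem hx']
      · have hx' : x + a ∉ Metric.ball a R := by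
          rw [Metric.mem_ball, dist_eq_norm, add_sub_cancel_right]
          rwa [Metric.mem_ball, dist_zero_right] at hx
        rw [Set.indicator_of_notMem hx, Set.indicator_of_notMem hx']
    -- translation invariance of the `L³` norm (no measurability needed)
    have htr : eLpNorm (fun x => (Metric.ball a R).indicator (v s) (x + a)) 3 volume =
        eLpNorm ((Metric.ball a R).indicator (v s)) 3 volume := by
      rw [eLpNorm_eq_lintegral_rpow_enorm_toReal (by norm_num) (by norm_num),
        eLpNorm_eq_lintegral_rpow_enorm_toReal (by norm_num) (by norm_num)]
      congr 1
      exact lintegral_add_right_eq_self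
        (fun x => ‖(Metric.ball a R).indicator (v s) x‖ₑ ^ (3 : ℝ≥0∞).toReal) a
    -- `B(a,R) ⊂ B(0,2R)`
    have hsub : Metric.ball a R ⊆ Metric.ball (0 : EuclideanSpace ℝ (Fin 3)) (2 * R) :=
      Metric.ball_subset_ball' (by rw [dist_zero_right]; linarith)
    have hmono : eLpNorm ((Metric.ball a R).indicator (v s)) 3 volume ≤
        eLpNorm ((Metric.ball (0 : EuclideanSpace ℝ (Fin 3)) (2 * R)).indicator (v s)) 3 volume :=
      eLpNorm_mono fun x => norm_indicator_le_of_subset hsub _ _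
    rw [e, htr]
    exact hmono.trans (hsl s hs)

/-- **`LogCubeLiouville → LogCubeFloorLiouville`** (bodies verbatim), with NO use of Q3: recentre at
the singular point produced by `exists_singularAt_of_localRateFloor`. [folklore] -/
theorem logCubeFloorLiouville_of_logCubeLiouville
    (hL : ∀ (M : ℝ) (v : ℝ → EuclideanSpace ℝ (Fin 3) → EuclideanSpace ℝ (Fin 3)),
      IsTypeIAncientMild M v → EnvelopeCubeBudget v → ¬ SingularAt v 0) :
    ∀ (M : ℝ) (v : ℝ → EuclideanSpace ℝ (Fin 3) → EuclideanSpace ℝ (Fin 3)),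
      IsTypeIAncientMild M v → EnvelopeCubeBudget v →
      ¬ ∃ c s₀ : ℝ, 0 < c ∧ s₀ < 0 ∧ ∀ s ∈ Set.Ico s₀ 0,
        ∃ x ∈ Metric.ball (0 : EuclideanSpace ℝ (Fin 3)) 1, c / Real.sqrt (-s) ≤ ‖v s x‖ := by
  intro M v hv hbud hfloor
  obtain ⟨a, ha, hsing⟩ := exists_singularAt_of_localRateFloor hfloor
  have ha' : ‖a‖ ≤ 1 := by rwa [Metric.mem_closedBall, dist_zero_right] at ha
  exact hL M _ (hv.comp_add_right a) (envelopeCubeBudget_comp_add_right ha' hbud)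
    (singularAt_comp_add_right hsing)

/-! ### 4. Placement: both values sit on the `FiniteDissipationLiouville` / 24453 wall -/

/-- **The rung: an ENVELOPED singular Type-I ancient mild field has a localised Leray floor**
(`LocalRateFloor`, body verbatim) — the landed global floor T4 (`stub_rateFloor`) and the envelope
`‖v‖ ≤ A/(‖x‖ + √(−s))` force the floor point into `B₁` once `√(−s) ≤ c/(2(A + c))`. This is the line
theorem `localRateFloor_of_hasTypeIDecay` of `quiet_collar` (ns-idea-7 g9), re-proved over `Theorems/`
imports. [folklore] -/
theorem localRateFloor_of_hasTypeIDecay_of_singularAt {M A : ℝ}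
    {v : ℝ → EuclideanSpace ℝ (Fin 3) → EuclideanSpace ℝ (Fin 3)}
    (hv : IsTypeIAncientMild M v) (hdec : HasTypeIDecay A v) (hsing : SingularAt v 0) :
    ∃ c s₀ : ℝ, 0 < c ∧ s₀ < 0 ∧ ∀ s ∈ Set.Ico s₀ 0,
      ∃ x ∈ Metric.ball (0 : EuclideanSpace ℝ (Fin 3)) 1, c / Real.sqrt (-s) ≤ ‖v s x‖ := by
  obtain ⟨c, hc, hfloor⟩ := stub_rateFloor M v hv hsing
  have hA : 0 ≤ A := by
    have h := hdec (-1) (by norm_num) 0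
    simp only [norm_zero, neg_neg, Real.sqrt_one, zero_add, div_one] at h
    exact (norm_nonneg _).trans h
  set η : ℝ := c / (2 * (A + c)) with hη
  have hηpos : 0 < η := by positivity
  have hη1 : η ^ 2 < 1 := by
    have hηlt : η < 1 := by
      rw [hη, div_lt_one (by positivity)]; nlinarith
    nlinarith
  refine ⟨c, -η ^ 2, hc, by nlinarith, fun s hs => ?_⟩
  obtain ⟨x, hx⟩ := hfloor s ⟨by linarith [hs.1], hs.2⟩
  have hspos : 0 < -s := by linarith [hs.2]
  have hsq : 0 < Real.sqrt (-s) := Real.sqrt_pos.2 hspos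
  have hsqη : Real.sqrt (-s) ≤ η := by
    calc Real.sqrt (-s) ≤ Real.sqrt (η ^ 2) := Real.sqrt_le_sqrt (by linarith [hs.1])
      _ = η := Real.sqrt_sq hηpos.le
  have henv : ‖v s x‖ ≤ A / (‖x‖ + Real.sqrt (-s)) := hdec s hs.2 x
  have hden : 0 < ‖x‖ + Real.sqrt (-s) := by positivity
  have h1 : c * (‖x‖ + Real.sqrt (-s)) ≤ A * Real.sqrt (-s) :=
    (div_le_div_iff₀ hsq hden).1 (hx.trans henv)
  have hx1 : ‖x‖ < 1 := by
    have h2 : c * ‖x‖ ≤ A * Real.sqrt (-s) := by nlinarith [norm_nonneg x]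
    have h3 : A * Real.sqrt (-s) ≤ A * η := mul_le_mul_of_nonneg_left hsqη hA
    have h4 : A * η < c := by
      rw [hη, ← mul_div_assoc, div_lt_iff₀ (by positivity)]
      nlinarith
    nlinarith
  exact ⟨x, by rwa [Metric.mem_ball, dist_zero_right], hx⟩

/-- **An enveloped singular Type-I ancient mild field refutes `LogCubeFloorLiouville`** (body
verbatim): budget by landed T3, floor by the rung. [folklore] -/
theorem not_logCubeFloorLiouville_of_envelopedSingular {M A : ℝ}
    {v : ℝ → EuclideanSpace ℝ (Fin 3) → EuclideanSpace ℝ (Fin 3)}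
    (hv : IsTypeIAncientMild M v) (hdec : HasTypeIDecay A v) (hsing : SingularAt v 0) :
    ¬ ∀ (M : ℝ) (v : ℝ → EuclideanSpace ℝ (Fin 3) → EuclideanSpace ℝ (Fin 3)),
      IsTypeIAncientMild M v → EnvelopeCubeBudget v →
      ¬ ∃ c s₀ : ℝ, 0 < c ∧ s₀ < 0 ∧ ∀ s ∈ Set.Ico s₀ 0,
        ∃ x ∈ Metric.ball (0 : EuclideanSpace ℝ (Fin 3)) 1, c / Real.sqrt (-s) ≤ ‖v s x‖ := by
  intro hL
  have hA : 0 ≤ A := by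
    have h := hdec (-1) (by norm_num) 0
    simp only [norm_zero, neg_neg, Real.sqrt_one, zero_add, div_one] at h
    exact (norm_nonneg _).trans h
  exact hL M v hv (stub_envelopeCubeBudget A v hA hdec)
    (localRateFloor_of_hasTypeIDecay_of_singularAt hv hdec hsing)

/-- **`¬ FiniteDissipationLiouville` (22144) refutes `LogCubeFloorLiouville`**: through the landed
`finiteDissipationLiouville_iff_envelopeLiouville`, a failure of 22144 is an enveloped singular
Type-I ancient mild field. Equivalently `LogCubeFloorLiouville → 22144`. [folklore] -/
theorem not_logCubeFloorLiouville_of_not_finiteDissipationLiouville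
    (h : ¬ Summit.NavierStokesRegularity.NavierStokesRegularity.Theses.LerayQuarterDissipation.FiniteDissipationLiouville) :
    ¬ ∀ (M : ℝ) (v : ℝ → EuclideanSpace ℝ (Fin 3) → EuclideanSpace ℝ (Fin 3)),
      IsTypeIAncientMild M v → EnvelopeCubeBudget v →
      ¬ ∃ c s₀ : ℝ, 0 < c ∧ s₀ < 0 ∧ ∀ s ∈ Set.Ico s₀ 0,
        ∃ x ∈ Metric.ball (0 : EuclideanSpace ℝ (Fin 3)) 1, c / Real.sqrt (-s) ≤ ‖v s x‖ := by
  intro hL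
  apply h
  rw [FiniteDissipationLiouville.Envelope.finiteDissipationLiouville_iff_envelopeLiouville]
  intro C A w hw hdec hsing
  exact not_logCubeFloorLiouville_of_envelopedSingular hw hdec (fun r hr B => hsing r hr B) hL

/-- **`¬ AsymmetricFlickerLiouville` (24453) refutes `LogCubeFloorLiouville`** (landed
`finiteDissipationLiouville_iff_asymmetricFlickerLiouville`). Equivalently the line's value implies
24453. [folklore] -/
theorem not_logCubeFloorLiouville_of_not_asymmetricFlickerLiouville
    (h : ¬ Summit.NavierStokesRegularity.NavierStokesRegularity.Theses.CalmSliceGate.AsymmetricFlickerLiouville) :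
    ¬ ∀ (M : ℝ) (v : ℝ → EuclideanSpace ℝ (Fin 3) → EuclideanSpace ℝ (Fin 3)),
      IsTypeIAncientMild M v → EnvelopeCubeBudget v →
      ¬ ∃ c s₀ : ℝ, 0 < c ∧ s₀ < 0 ∧ ∀ s ∈ Set.Ico s₀ 0,
        ∃ x ∈ Metric.ball (0 : EuclideanSpace ℝ (Fin 3)) 1, c / Real.sqrt (-s) ≤ ‖v s x‖ :=
  not_logCubeFloorLiouville_of_not_finiteDissipationLiouville fun hFDL =>
    h (AsymmetricFlickerLiouville.Negative.finiteDissipationLiouville_iff_asymmetricFlickerLiouville.1 hFDL)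

/-- **A failure of `TypeIDSSLiouvilleConjecture` refutes `LogCubeFloorLiouville`** (landed
`Hardness.not_finiteDissipationLiouville_of_not_typeIDSSLiouvilleConjecture`). [folklore] -/
theorem not_logCubeFloorLiouville_of_not_typeIDSSLiouvilleConjecture
    (h : ¬ _root_.Summit.NavierStokesRegularity.NavierStokesRegularity.TypeIDSSLiouvilleConjecture) :
    ¬ ∀ (M : ℝ) (v : ℝ → EuclideanSpace ℝ (Fin 3) → EuclideanSpace ℝ (Fin 3)),
      IsTypeIAncientMild M v → EnvelopeCubeBudget v →
      ¬ ∃ c s₀ : ℝ, 0 < c ∧ s₀ < 0 ∧ ∀ s ∈ Set.Ico s₀ 0,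
        ∃ x ∈ Metric.ball (0 : EuclideanSpace ℝ (Fin 3)) 1, c / Real.sqrt (-s) ≤ ‖v s x‖ :=
  not_logCubeFloorLiouville_of_not_finiteDissipationLiouville
    (FiniteDissipationLiouville.Hardness.not_finiteDissipationLiouville_of_not_typeIDSSLiouvilleConjecture h)

/-- **INSTRUMENT ROW AS THEOREM: any Type-I (rotated-)DSS profile refutes `LogCubeFloorLiouville`**
(every ratio `c > 1`, every isometry `R`; landed `Hardness.not_finiteDissipationLiouville_of_isTypeIDSSProfile`).
[folklore] -/
theorem not_logCubeFloorLiouville_of_isTypeIDSSProfile {c : ℝ}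
    {R : EuclideanSpace ℝ (Fin 3) ≃ₗᵢ[ℝ] EuclideanSpace ℝ (Fin 3)}
    {u : ℝ → EuclideanSpace ℝ (Fin 3) → EuclideanSpace ℝ (Fin 3)} (h : IsTypeIDSSProfile c R u) :
    ¬ ∀ (M : ℝ) (v : ℝ → EuclideanSpace ℝ (Fin 3) → EuclideanSpace ℝ (Fin 3)),
      IsTypeIAncientMild M v → EnvelopeCubeBudget v →
      ¬ ∃ c s₀ : ℝ, 0 < c ∧ s₀ < 0 ∧ ∀ s ∈ Set.Ico s₀ 0,
        ∃ x ∈ Metric.ball (0 : EuclideanSpace ℝ (Fin 3)) 1, c / Real.sqrt (-s) ≤ ‖v s x‖ :=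
  not_logCubeFloorLiouville_of_not_finiteDissipationLiouville
    (FiniteDissipationLiouville.Hardness.not_finiteDissipationLiouville_of_isTypeIDSSProfile h)

/-- **The same rows refute `LogCubeLiouville`** (the stronger value; via §3). [folklore] -/
theorem not_logCubeLiouville_of_not_finiteDissipationLiouville
    (h : ¬ Summit.NavierStokesRegularity.NavierStokesRegularity.Theses.LerayQuarterDissipation.FiniteDissipationLiouville) :
    ¬ ∀ (M : ℝ) (v : ℝ → EuclideanSpace ℝ (Fin 3) → EuclideanSpace ℝ (Fin 3)),
      IsTypeIAncientMild M v → EnvelopeCubeBudget v → ¬ SingularAt v 0 :=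
  fun hL => not_logCubeFloorLiouville_of_not_finiteDissipationLiouville h
    (logCubeFloorLiouville_of_logCubeLiouville hL)

/-- `¬ AsymmetricFlickerLiouville` (24453) refutes `LogCubeLiouville`. [folklore] -/
theorem not_logCubeLiouville_of_not_asymmetricFlickerLiouville
    (h : ¬ Summit.NavierStokesRegularity.NavierStokesRegularity.Theses.CalmSliceGate.AsymmetricFlickerLiouville) :
    ¬ ∀ (M : ℝ) (v : ℝ → EuclideanSpace ℝ (Fin 3) → EuclideanSpace ℝ (Fin 3)),
      IsTypeIAncientMild M v → EnvelopeCubeBudget v → ¬ SingularAt v 0 :=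
  fun hL => not_logCubeFloorLiouville_of_not_asymmetricFlickerLiouville h
    (logCubeFloorLiouville_of_logCubeLiouville hL)

/-- Any Type-I (rotated-)DSS profile refutes `LogCubeLiouville`. [folklore] -/
theorem not_logCubeLiouville_of_isTypeIDSSProfile {c : ℝ}
    {R : EuclideanSpace ℝ (Fin 3) ≃ₗᵢ[ℝ] EuclideanSpace ℝ (Fin 3)}
    {u : ℝ → EuclideanSpace ℝ (Fin 3) → EuclideanSpace ℝ (Fin 3)} (h : IsTypeIDSSProfile c R u) :
    ¬ ∀ (M : ℝ) (v : ℝ → EuclideanSpace ℝ (Fin 3) → EuclideanSpace ℝ (Fin 3)),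
      IsTypeIAncientMild M v → EnvelopeCubeBudget v → ¬ SingularAt v 0 :=
  fun hL => not_logCubeFloorLiouville_of_isTypeIDSSProfile h
    (logCubeFloorLiouville_of_logCubeLiouville hL)

end Summit.NavierStokesRegularity.NavierStokesRegularity.Theorems.TypeIQuantSubcubicExp.Negative
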